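import Literature.NumberTheory.Automorphic.BLZPeriodCocycle
import Literature.Analysis.Complex.RectangleContourTools
import HarnessLib

/-!
# The Bruggeman–Lewis–Zagier period cocycle takes values in the analytic vectors — proof

Discharge of the named fact `BruggemanLewisZagier2015_cocycle_analytic` of
`Literature/NumberTheory/Automorphic/BLZPeriodCocycle.lean`: Bruggeman–Lewis–Zagier, *Period
functions for Maass wave forms and cohomology*, Mem. AMS 237 no. 1118 (2015), p. 29 (after
(5.5a)): "So `r_γ ∈ V_s^ω`" — the period function `r_γ(t) = ∫_{γ⁻¹ z₀}^{z₀} [u, R(t; ·)^s]` is an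
analytic vector of the line model (`IsAnalyticVector`: real-analytic on `ℝ`, and
`|t|^{-2s} r_γ(-1/t)` extends analytically across `t = 0`).

## The printed argument and how it is formalised

BLZ (1.7), p. 10: moving `t` off the real line, `R(ζ; z)^s = y^s / ((ζ - z)^s (ζ - z̄)^s)` is
holomorphic in `ζ` away from `z`, `z̄`; the Green's form `[u, R(ζ; ·)^s]` ((1.9), p. 11) is then
holomorphic in `ζ`, and so is its integral over a compact path in `ℍ` ((5.5a), p. 29), in a complex
neighbourhood of `ℝ`; holomorphy near the real axis is real-analyticity on `ℝ`. At `∞` one uses the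
equivariance `R(·; g z)|_{2s} g = R(·; z)^s` ((2.25), p. 16) with `g = S`:
`|t|^{-2s} R(-1/t; z)^s = R(t; -1/z)^s = (y / ((1 + t z)(1 + t z̄)))^s`, holomorphic near `t = 0`.

Concretely (everything below is proved; no definitions, no new named facts):

* `wirtingerDzbar_hypPoissonKernelCpow` — the explicit `z̄`-derivative
  `∂_z̄ R(t; ·)^s (z) = (i s / 2) R(t; z)^{s-1} / (t - z̄)²`, from `R(t; z) = Im (1/(t - z))` ((1.6));
* `greenForm_hypPoissonKernelCpow` / `greenForm_hypPoissonKernelCpow_infty` — the integrand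
  `[U, R(t; ·)^s](z)` as a rational–power expression in `t`, and the same for
  `|t|^{-2s} [U, R(-1/t; ·)^s](z)` in a form regular at `t = 0`;
* `analyticAt_intervalIntegral_of_differentiableOn` — `t ↦ ∫₀¹ K(t, τ) dτ` is real-analytic at
  `t₀` when `K(ζ, τ)` is holomorphic in `ζ` on an open `U ∋ t₀` for each `τ ∈ [0,1]` and jointly
  continuous on `U × [0,1]` (the Literature theorem
  `Literature.Analysis.Complex.differentiableOn_intervalIntegral_of_continuousOn`, i.e. dominated
  differentiation with Cauchy estimates, followed by `DifferentiableOn.analyticAt` and restriction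
  of scalars along `ℝ ↪ ℂ`);
* `isAnalyticVector_greenSegmentIntegral`, `isAnalyticVector_greenPeriod` — for ANY `U : ℂ → ℂ`
  continuous with continuous real derivative on `{Im z > 0}` (in particular `u ∘ ofComplex` for
  `u` of class `C²` on `ℍ`), any `a, b` in the open upper half-plane and any `s ∈ ℂ`, the segment
  period `t ↦ ∫_a^b [U, R(t; ·)^s]` is an analytic vector (the eigenfunction property, the group and
  `0 < Re s < 1` play no role in this statement);
* `BruggemanLewisZagier2015_cocycle_analytic_holds` — the named fact.

## References

* [BruggemanLewisZagier2015] R. Bruggeman, J. Lewis, D. Zagier, *Period functions for Maass wave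
  forms and cohomology*, Mem. Amer. Math. Soc. 237 (2015), no. 1118, doi:10.1090/memo/1118
  (held copy `paper:doi-10-1090-memo-1118`, PDF pages): (1.6)–(1.7) p. 10; (1.9) p. 11;
  (2.1)–(2.2) pp. 11–12; (2.25) p. 16; (5.5a) and "So `r_γ ∈ V_s^ω`" p. 29.
-/

noncomputable section

namespace Literature.NumberTheory.Automorphic

open _root_.Complex _root_.Filter _root_.Set _root_.MeasureTheory
open scoped Topology ComplexConjugate

/-! ### 1. Interval integrals with holomorphic parameter dependence are real-analytic -/

/-- **Real-analyticity of a parameter integral by complexification.** If `K ζ τ` is complex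
differentiable in `ζ` on an open set `U ⊆ ℂ` containing the real point `t₀` for every
`τ ∈ [0, 1]`, and `(ζ, τ) ↦ K ζ τ` is continuous on `U × [0, 1]`, then
`t ↦ ∫₀¹ K t τ dτ` (`t` real) is real-analytic at `t₀`: the integral is holomorphic on `U`
(`Literature.Analysis.Complex.differentiableOn_intervalIntegral_of_continuousOn`), hence complex
analytic at `t₀`, and composition with `ℝ ↪ ℂ` is real-analytic. [folklore] -/
theorem analyticAt_intervalIntegral_of_differentiableOn {K : ℂ → ℝ → ℂ} {U : Set ℂ}
    (hU : IsOpen U) {t₀ : ℝ} (ht₀ : (t₀ : ℂ) ∈ U)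
    (hdiff : ∀ τ ∈ Icc (0 : ℝ) 1, DifferentiableOn ℂ (fun ζ => K ζ τ) U)
    (hcont : ContinuousOn (Function.uncurry K) (U ×ˢ Icc (0 : ℝ) 1)) :
    AnalyticAt ℝ (fun t : ℝ => ∫ τ in (0 : ℝ)..1, K t τ) t₀ := by
  have hD : DifferentiableOn ℂ (fun ζ => ∫ τ in (0 : ℝ)..1, K ζ τ) U :=
    Literature.Analysis.Complex.differentiableOn_intervalIntegral_of_continuousOn hU zero_le_one
      hdiff hcont
  have hA : AnalyticAt ℂ (fun ζ => ∫ τ in (0 : ℝ)..1, K ζ τ) (t₀ : ℂ) :=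
    hD.analyticAt (hU.mem_nhds ht₀)
  exact (hA.restrictScalars (𝕜 := ℝ)).comp (Complex.ofRealCLM.analyticAt t₀)

/-! ### 2. The Poisson kernel: complex form and `z̄`-derivative of its power -/

/-- `R(t; z) = Im (1 / (t - z))` (BLZ (1.6)). [cite: BruggemanLewisZagier2015, (1.6) p. 10] -/
theorem hypPoissonKernel_eq_im_inv (t : ℝ) (w : ℂ) :
    hypPoissonKernel t w = (((t : ℂ) - w)⁻¹).im := by
  rw [Complex.inv_im, ← Complex.normSq_neg, neg_sub, Complex.normSq_eq_norm_sq, hypPoissonKernel]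
  simp

/-- Complex form of the Poisson kernel: `R(t; z) = y / ((z - t)(z̄ - t))` (`= y / |z - t|²`).
[cite: BruggemanLewisZagier2015, (1.6)–(1.7) p. 10] -/
theorem ofReal_hypPoissonKernel (t : ℝ) (z : ℂ) :
    ((hypPoissonKernel t z : ℝ) : ℂ) = (z.im : ℂ) / ((z - t) * (conj z - t)) := by
  rw [hypPoissonKernel, Complex.ofReal_div, Complex.sq_norm, ← Complex.mul_conj, map_sub,
    Complex.conj_ofReal]

/-- For every `d ∈ ℂ`: `Im d + i · Im (i d) = i d̄`. [folklore] -/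
theorem im_add_I_mul_im_I_mul (d : ℂ) :
    (((1 * d).im : ℝ) : ℂ) + I * (((I * d).im : ℝ) : ℂ) = I * conj d := by
  apply Complex.ext <;> simp

/-- **The `z̄`-derivative of `R(t; ·)^s`.** For `t ∈ ℝ` and `Im z > 0`,
`∂_z̄ (R(t; ·)^s)(z) = (i s / 2) · R(t; z)^{s-1} / (t - z̄)²`. (From `R(t; z) = Im (1/(t - z))`:
`∂_x R = Im (t-z)⁻²`, `∂_y R = Re (t-z)⁻²`, so `(∂_x + i∂_y) R = i · conj((t - z)⁻²)`.)
[cite: BruggemanLewisZagier2015, (1.6)–(1.7) p. 10] -/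
theorem wirtingerDzbar_hypPoissonKernelCpow (s : ℂ) (t : ℝ) {z : ℂ} (hz : 0 < z.im) :
    wirtingerDzbar (hypPoissonKernelCpow s t) z =
      I * s / 2 * ((hypPoissonKernel t z : ℝ) : ℂ) ^ (s - 1) / ((t : ℂ) - conj z) ^ 2 := by
  have he : (t : ℂ) - z ≠ 0 := by
    intro e
    have := congrArg Complex.im e
    simp at this
    linarith
  -- `w ↦ (t - w)⁻¹` is holomorphic at `z` with derivative `d = (t - z)⁻²`
  set d : ℂ := (((t : ℂ) - z) ^ 2)⁻¹ with hd
  have h1 : HasDerivAt (fun w : ℂ => ((t : ℂ) - w)⁻¹) d z := by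
    have h := (hasDerivAt_inv he).comp z ((hasDerivAt_id' z).const_sub (t : ℂ))
    have e : -(((t : ℂ) - z) ^ 2)⁻¹ * -1 = d := by rw [hd]; ring
    rw [e] at h
    exact h
  set L : ℂ →L[ℝ] ℂ := ((1 : ℂ →L[ℂ] ℂ).smulRight d).restrictScalars ℝ with hL
  have h2 : HasFDerivAt (fun w : ℂ => ((t : ℂ) - w)⁻¹) L z := h1.hasFDerivAt.restrictScalars ℝ
  -- the real Fréchet derivative of `R(t; ·) = Im ∘ (t - ·)⁻¹`
  have h3 : HasFDerivAt (hypPoissonKernel t) (Complex.imCLM.comp L) z := by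
    have h := Complex.imCLM.hasFDerivAt.comp z h2
    refine h.congr_of_eventuallyEq (Eventually.of_forall fun w => ?_)
    exact hypPoissonKernel_eq_im_inv t w
  -- the outer function `q ↦ q ^ s` at the positive real `q₀ = R(t; z)`
  have hP : 0 < hypPoissonKernel t z := hypPoissonKernel_pos t hz
  have hslit : ((hypPoissonKernel t z : ℝ) : ℂ) ∈ slitPlane := Complex.ofReal_mem_slitPlane.2 hP
  have h4 : HasDerivAt (fun q : ℂ => q ^ s)
      (s * ((hypPoissonKernel t z : ℝ) : ℂ) ^ (s - 1)) ((hypPoissonKernel t z : ℝ) : ℂ) :=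
    (Complex.hasStrictDerivAt_cpow_const hslit).hasDerivAt
  have h5 : HasFDerivAt (fun w : ℂ => ((hypPoissonKernel t w : ℝ) : ℂ))
      (Complex.ofRealCLM.comp (Complex.imCLM.comp L)) z :=
    Complex.ofRealCLM.hasFDerivAt.comp z h3
  have h6 := h4.comp_hasFDerivAt_of_eq z h5 rfl
  have ev : ∀ v : ℂ, ((s * ((hypPoissonKernel t z : ℝ) : ℂ) ^ (s - 1)) •
        (Complex.ofRealCLM.comp (Complex.imCLM.comp L))) v =
      s * ((hypPoissonKernel t z : ℝ) : ℂ) ^ (s - 1) * (((v * d).im : ℝ) : ℂ) := by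
    intro v
    simp [hL]
  rw [wirtingerDzbar, show hypPoissonKernelCpow s t =
      ((fun q : ℂ => q ^ s) ∘ fun w : ℂ => ((hypPoissonKernel t w : ℝ) : ℂ)) from rfl,
    h6.fderiv, ev, ev]
  have hconj : conj d = (((t : ℂ) - conj z) ^ 2)⁻¹ := by
    simp only [hd, map_inv₀, map_pow, map_sub, Complex.conj_ofReal]
  have key := im_add_I_mul_im_I_mul d
  rw [hconj] at key
  linear_combination (s * ((hypPoissonKernel t z : ℝ) : ℂ) ^ (s - 1) / 2) * key

/-- **The integrand of the period integral, explicitly.** For `Im z > 0`, `t ∈ ℝ`: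
`[U, R(t;·)^s](z)(h) = U_z(z) P^s h + U(z) (i s/2) P^{s-1} (t - z̄)^{-2} h̄` with
`P = y / ((z - t)(z̄ - t))`. [cite: BruggemanLewisZagier2015, (1.9) p. 11] -/
theorem greenForm_hypPoissonKernelCpow (s : ℂ) (U : ℂ → ℂ) (t : ℝ) {z : ℂ} (hz : 0 < z.im)
    (h : ℂ) :
    greenForm U (hypPoissonKernelCpow s t) z h =
      wirtingerDz U z * ((z.im : ℂ) / ((z - t) * (conj z - t))) ^ s * h +
        U z * (I * s / 2 * ((z.im : ℂ) / ((z - t) * (conj z - t))) ^ (s - 1) /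
          ((t : ℂ) - conj z) ^ 2) * conj h := by
  rw [greenForm, wirtingerDzbar_hypPoissonKernelCpow s t hz, hypPoissonKernelCpow,
    ofReal_hypPoissonKernel t z]

/-- `|t|^{-2s} (t² q)^w = (t²)^{w-s} q^w` for `t ≠ 0`, `q ≥ 0` (principal branches of real
bases). [folklore] -/
theorem abs_cpow_neg_mul_sq_mul_cpow {t : ℝ} (ht : t ≠ 0) {q : ℝ} (hq : 0 ≤ q) (s w : ℂ) :
    ((|t| : ℝ) : ℂ) ^ (-(2 * s)) * ((t ^ 2 * q : ℝ) : ℂ) ^ w =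
      ((t ^ 2 : ℝ) : ℂ) ^ (w - s) * (q : ℂ) ^ w := by
  have habs : ((|t| : ℝ) : ℂ) ^ (-(2 * s)) = ((t ^ 2 : ℝ) : ℂ) ^ (-s) := by
    have hne : ((|t| : ℝ) : ℂ) ≠ 0 := by exact_mod_cast (abs_pos.mpr ht).ne'
    rw [show (t ^ 2 : ℝ) = |t| * |t| by rw [← sq_abs]; ring, Complex.ofReal_mul,
      Complex.mul_cpow_ofReal_nonneg (abs_nonneg t) (abs_nonneg t),
      ← Complex.cpow_add _ _ hne]
    congr 1
    ring
  have ht2 : ((t ^ 2 : ℝ) : ℂ) ≠ 0 := by exact_mod_cast pow_ne_zero 2 ht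
  rw [habs, Complex.ofReal_mul, Complex.mul_cpow_ofReal_nonneg (sq_nonneg t) hq, ← mul_assoc,
    ← Complex.cpow_add _ _ ht2]
  congr 2
  ring

/-- **The integrand at infinity, explicitly.** For `Im z > 0`, `t ∈ ℝ ∖ {0}`:
`|t|^{-2s} [U, R(-1/t;·)^s](z)(h) = U_z(z) Q^s h + U(z) (i s/2) Q^{s-1} (1 + t z̄)^{-2} h̄` with
`Q = y / ((1 + t z)(1 + t z̄)) = R(t; -1/z)` — an expression regular at `t = 0` (this is
`R(·; -1/z)^s = R(·; z)^s |_{2s} S`, BLZ (2.25) with `g = S`).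
[cite: BruggemanLewisZagier2015, (2.25) p. 16] -/
theorem greenForm_hypPoissonKernelCpow_infty (s : ℂ) (U : ℂ → ℂ) {t : ℝ} (ht : t ≠ 0) {z : ℂ}
    (hz : 0 < z.im) (h : ℂ) :
    ((|t| : ℝ) : ℂ) ^ (-(2 * s)) * greenForm U (hypPoissonKernelCpow s (-1 / t)) z h =
      wirtingerDz U z * ((z.im : ℂ) / ((1 + t * z) * (1 + t * conj z))) ^ s * h +
        U z * (I * s / 2 * ((z.im : ℂ) / ((1 + t * z) * (1 + t * conj z))) ^ (s - 1) /
          (1 + (t : ℂ) * conj z) ^ 2) * conj h := by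
  rw [greenForm, wirtingerDzbar_hypPoissonKernelCpow s (-1 / t) hz, hypPoissonKernelCpow]
  set p : ℝ := hypPoissonKernel (-1 / t) z with hp_def
  set q : ℝ := p / t ^ 2 with hq_def
  have hp0 : 0 < p := hypPoissonKernel_pos _ hz
  have hq0 : 0 ≤ q := by positivity
  have hpq : p = t ^ 2 * q := by
    rw [hq_def, mul_div_cancel₀ _ (pow_ne_zero 2 ht)]
  have htc : (t : ℂ) ≠ 0 := by exact_mod_cast ht
  have e0 : (z - ((-1 / t : ℝ) : ℂ)) * (conj z - ((-1 / t : ℝ) : ℂ)) * (t : ℂ) ^ 2 =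
      (1 + (t : ℂ) * z) * (1 + (t : ℂ) * conj z) := by
    push_cast
    field_simp
    ring
  have hq : ((q : ℝ) : ℂ) = (z.im : ℂ) / ((1 + (t : ℂ) * z) * (1 + (t : ℂ) * conj z)) := by
    rw [hq_def, Complex.ofReal_div, Complex.ofReal_pow, hp_def, ofReal_hypPoissonKernel, div_div, e0]
  have e1 : ((|t| : ℝ) : ℂ) ^ (-(2 * s)) * (p : ℂ) ^ s = (q : ℂ) ^ s := by
    rw [hpq, abs_cpow_neg_mul_sq_mul_cpow ht hq0 s s, sub_self, Complex.cpow_zero, one_mul]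
  have e2 : ((|t| : ℝ) : ℂ) ^ (-(2 * s)) * (p : ℂ) ^ (s - 1) = (q : ℂ) ^ (s - 1) / (t : ℂ) ^ 2 := by
    rw [hpq, abs_cpow_neg_mul_sq_mul_cpow ht hq0 s (s - 1), show s - 1 - s = -1 by ring,
      Complex.cpow_neg_one]
    push_cast
    ring
  have e3 : (t : ℂ) ^ 2 * ((((-1 / t : ℝ) : ℂ)) - conj z) ^ 2 = (1 + (t : ℂ) * conj z) ^ 2 := by
    push_cast
    field_simp
    ring
  have e4 : I * s / 2 * ((q : ℂ) ^ (s - 1) / (t : ℂ) ^ 2) / ((((-1 / t : ℝ) : ℂ)) - conj z) ^ 2 =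
      I * s / 2 * (q : ℂ) ^ (s - 1) / (1 + (t : ℂ) * conj z) ^ 2 := by
    rw [← e3, ← mul_div_assoc, div_div]
  calc ((|t| : ℝ) : ℂ) ^ (-(2 * s)) *
        (wirtingerDz U z * (p : ℂ) ^ s * h +
          U z * (I * s / 2 * (p : ℂ) ^ (s - 1) / ((((-1 / t : ℝ) : ℂ)) - conj z) ^ 2) * conj h)
      = wirtingerDz U z * (((|t| : ℝ) : ℂ) ^ (-(2 * s)) * (p : ℂ) ^ s) * h +
          U z * (I * s / 2 * (((|t| : ℝ) : ℂ) ^ (-(2 * s)) * (p : ℂ) ^ (s - 1)) /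
            ((((-1 / t : ℝ) : ℂ)) - conj z) ^ 2) * conj h := by ring
    _ = wirtingerDz U z * (q : ℂ) ^ s * h +
          U z * (I * s / 2 * ((q : ℂ) ^ (s - 1) / (t : ℂ) ^ 2) /
            ((((-1 / t : ℝ) : ℂ)) - conj z) ^ 2) * conj h := by rw [e1, e2]
    _ = _ := by rw [e4, hq]

/-! ### 3. Geometry of the segment and the two complex parameter domains -/

/-- On the segment `τ ↦ (1-τ) a + τ b`, `τ ∈ [0,1]`, the imaginary part is at least
`min (Im a) (Im b)`. [folklore] -/
theorem min_im_le_segment_im {a b : ℂ} {τ : ℝ} (hτ : τ ∈ Icc (0 : ℝ) 1) :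
    min a.im b.im ≤ ((1 - (τ : ℂ)) * a + τ * b).im := by
  have e : ((1 - (τ : ℂ)) * a + τ * b).im = (1 - τ) * a.im + τ * b.im := by
    simp
  rw [e]
  have h1 := min_le_left a.im b.im
  have h2 := min_le_right a.im b.im
  nlinarith [mul_nonneg (sub_nonneg.2 hτ.2) (sub_nonneg.2 h1), mul_nonneg hτ.1 (sub_nonneg.2 h2)]

/-- On the segment `τ ↦ (1-τ) a + τ b`, `τ ∈ [0,1]`, the norm is at most `‖a‖ + ‖b‖`.
[folklore] -/
theorem norm_segment_le {a b : ℂ} {τ : ℝ} (hτ : τ ∈ Icc (0 : ℝ) 1) :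
    ‖(1 - (τ : ℂ)) * a + τ * b‖ ≤ ‖a‖ + ‖b‖ := by
  have h1 : ‖(1 - (τ : ℂ)) * a‖ ≤ ‖a‖ := by
    rw [norm_mul]
    have : ‖(1 - (τ : ℂ))‖ ≤ 1 := by
      rw [show (1 - (τ : ℂ)) = ((1 - τ : ℝ) : ℂ) by push_cast; ring, Complex.norm_real,
        Real.norm_eq_abs, abs_le]
      constructor <;> linarith [hτ.1, hτ.2]
    exact mul_le_of_le_one_left (norm_nonneg _) this
  have h2 : ‖(τ : ℂ) * b‖ ≤ ‖b‖ := by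
    rw [norm_mul, Complex.norm_real, Real.norm_eq_abs, abs_of_nonneg hτ.1]
    exact mul_le_of_le_one_left (norm_nonneg _) hτ.2
  exact (norm_add_le _ _).trans (add_le_add h1 h2)

/-- `y / D` lies in the slit plane when `Re D > 0` and `y > 0`. [folklore] -/
theorem ofReal_div_mem_slitPlane {D : ℂ} {y : ℝ} (hD : 0 < D.re) (hy : 0 < y) :
    (y : ℂ) / D ∈ slitPlane := by
  rw [Complex.mem_slitPlane_iff]
  left
  have hn : 0 < Complex.normSq D := Complex.normSq_pos.2 (fun e => by rw [e] at hD; simp at hD)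
  rw [Complex.div_re]
  simp only [Complex.ofReal_re, Complex.ofReal_im, zero_mul, zero_div, add_zero]
  positivity

/-- **The strip `|Im ζ| < Im z`.** There `z - ζ ≠ 0`, `z̄ - ζ ≠ 0` and
`y / ((z - ζ)(z̄ - ζ))` (the continuation of `R(ζ; z)`, BLZ (1.7)) lies in the slit plane.
[cite: BruggemanLewisZagier2015, (1.7) p. 10] -/
theorem poisson_strip_aux {ζ z : ℂ} (h : |ζ.im| < z.im) :
    z - ζ ≠ 0 ∧ conj z - ζ ≠ 0 ∧ (z.im : ℂ) / ((z - ζ) * (conj z - ζ)) ∈ slitPlane := by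
  obtain ⟨h1, h2⟩ := abs_lt.1 h
  have hy : 0 < z.im := lt_of_le_of_lt (abs_nonneg _) h
  refine ⟨?_, ?_, ?_⟩
  · intro e
    have := congrArg Complex.im e
    simp at this
    linarith
  · intro e
    have := congrArg Complex.im e
    simp at this
    linarith
  · apply ofReal_div_mem_slitPlane _ hy
    have e : ((z - ζ) * (conj z - ζ)).re = (z.re - ζ.re) ^ 2 + (z.im ^ 2 - ζ.im ^ 2) := by
      simp only [Complex.mul_re, Complex.sub_re, Complex.sub_im, Complex.conj_re, Complex.conj_im]
      ring
    rw [e]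
    have h3 : ζ.im ^ 2 < z.im ^ 2 := sq_lt_sq' (by linarith) h2
    nlinarith [sq_nonneg (z.re - ζ.re)]

/-- **The disc at infinity.** If `‖ζ‖ ‖z‖ ≤ 1/4` and `Im z > 0` then `1 + ζ z ≠ 0`,
`1 + ζ z̄ ≠ 0` and `y / ((1 + ζ z)(1 + ζ z̄))` (the continuation of `R(ζ; -1/z)`) lies in the
slit plane. [cite: BruggemanLewisZagier2015, (1.7) p. 10] -/
theorem poisson_disc_aux {ζ z : ℂ} (hz : 0 < z.im) (h : ‖ζ‖ * ‖z‖ ≤ 1 / 4) :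
    1 + ζ * z ≠ 0 ∧ 1 + ζ * conj z ≠ 0 ∧
      (z.im : ℂ) / ((1 + ζ * z) * (1 + ζ * conj z)) ∈ slitPlane := by
  have hρ1 : ‖ζ * z‖ ≤ 1 / 4 := by rwa [norm_mul]
  have hρ2 : ‖ζ * conj z‖ ≤ 1 / 4 := by rwa [norm_mul, Complex.norm_conj]
  have ne1 : ∀ v : ℂ, ‖v‖ ≤ 1 / 4 → 1 + v ≠ 0 := by
    intro v hv e
    have hv1 : v = -1 := by linear_combination e
    rw [hv1, norm_neg, norm_one] at hv
    norm_num at hv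
  refine ⟨ne1 _ hρ1, ne1 _ hρ2, ?_⟩
  apply ofReal_div_mem_slitPlane _ hz
  have e : (1 + ζ * z) * (1 + ζ * conj z) = 1 + (ζ * z + ζ * conj z + ζ * z * (ζ * conj z)) := by
    ring
  rw [e, Complex.add_re, Complex.one_re]
  have hb : ‖ζ * z + ζ * conj z + ζ * z * (ζ * conj z)‖ ≤ 1 / 4 + 1 / 4 + 1 / 4 * (1 / 4) := by
    refine (norm_add_le _ _).trans (add_le_add ((norm_add_le _ _).trans (add_le_add hρ1 hρ2)) ?_)
    rw [norm_mul]
    exact mul_le_mul hρ1 hρ2 (norm_nonneg _) (by norm_num)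
  have hre := neg_le_of_abs_le ((Complex.abs_re_le_norm _).trans hb)
  linarith

/-- Along the segment from `a` to `b` in the open upper half-plane, `τ ↦ U(z_τ)` and
`τ ↦ U_z(z_τ)` are continuous on `[0, 1]` when `U` and its real derivative are continuous on
`{Im z > 0}`. [folklore] -/
theorem continuousOn_segment_aux {U : ℂ → ℂ} (hUc : ContinuousOn U {z : ℂ | 0 < z.im})
    (hUd : ContinuousOn (fderiv ℝ U) {z : ℂ | 0 < z.im}) {a b : ℂ} (ha : 0 < a.im)
    (hb : 0 < b.im) :
    ContinuousOn (fun τ : ℝ => U ((1 - (τ : ℂ)) * a + τ * b)) (Icc 0 1) ∧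
      ContinuousOn (fun τ : ℝ => wirtingerDz U ((1 - (τ : ℂ)) * a + τ * b)) (Icc 0 1) := by
  have hw : Continuous fun τ : ℝ => (1 - (τ : ℂ)) * a + τ * b := by fun_prop
  have hmaps : MapsTo (fun τ : ℝ => (1 - (τ : ℂ)) * a + τ * b) (Icc 0 1) {z : ℂ | 0 < z.im} :=
    fun τ hτ => (lt_min ha hb).trans_le (min_im_le_segment_im hτ)
  refine ⟨hUc.comp hw.continuousOn hmaps, ?_⟩
  have h1 : ContinuousOn (fun τ : ℝ => fderiv ℝ U ((1 - (τ : ℂ)) * a + τ * b)) (Icc 0 1) :=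
    hUd.comp hw.continuousOn hmaps
  simp only [wirtingerDz]
  exact ((h1.clm_apply continuousOn_const).sub
    (continuousOn_const.mul (h1.clm_apply continuousOn_const))).div_const _

/-! ### 4. Analyticity on `ℝ` and at `∞` -/

/-- **The strip lemma.** For a continuous path `w : [0,1] → {Im z ≥ m}` (`m > 0`), continuous
coefficients `A`, `B` on `[0, 1]` and constants `s, h₁, h₂`, the function
`t ↦ ∫₀¹ (A P_t^s h₁ + B (i s/2) P_t^{s-1} (t - w̄)^{-2} h₂) dτ`, `P_t = Im w / ((w - t)(w̄ - t))`,
is real-analytic at every real `t₀`: the integrand continues holomorphically in `t` to the strip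
`|Im ζ| < m` (BLZ (1.7)), jointly continuously. [cite: BruggemanLewisZagier2015, (1.7) p. 10] -/
theorem analyticAt_integral_strip (s h₁ h₂ : ℂ) {A B w : ℝ → ℂ} {m : ℝ} (hm : 0 < m)
    (hA : ContinuousOn A (Icc 0 1)) (hB : ContinuousOn B (Icc 0 1)) (hw : Continuous w)
    (hwm : ∀ τ ∈ Icc (0 : ℝ) 1, m ≤ (w τ).im) (t₀ : ℝ) :
    AnalyticAt ℝ (fun t : ℝ => ∫ τ in (0 : ℝ)..1,
      (A τ * (((w τ).im : ℂ) / ((w τ - t) * (conj (w τ) - t))) ^ s * h₁ +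
        B τ * (I * s / 2 * (((w τ).im : ℂ) / ((w τ - t) * (conj (w τ) - t))) ^ (s - 1) /
          ((t : ℂ) - conj (w τ)) ^ 2) * h₂)) t₀ := by
  have hS : IsOpen {ζ : ℂ | |ζ.im| < m} :=
    isOpen_lt (continuous_abs.comp Complex.continuous_im) continuous_const
  have ht₀ : (t₀ : ℂ) ∈ {ζ : ℂ | |ζ.im| < m} := by
    simp only [mem_setOf_eq, Complex.ofReal_im, abs_zero]
    exact hm
  have hT : ∀ p ∈ {ζ : ℂ | |ζ.im| < m} ×ˢ Icc (0 : ℝ) 1, |(p.1 : ℂ).im| < (w p.2).im :=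
    fun p hp => lt_of_lt_of_le hp.1 (hwm _ hp.2)
  refine analyticAt_intervalIntegral_of_differentiableOn
    (K := fun ζ τ => A τ * (((w τ).im : ℂ) / ((w τ - ζ) * (conj (w τ) - ζ))) ^ s * h₁ +
        B τ * (I * s / 2 * (((w τ).im : ℂ) / ((w τ - ζ) * (conj (w τ) - ζ))) ^ (s - 1) /
          (ζ - conj (w τ)) ^ 2) * h₂) hS ht₀ ?_ ?_
  · -- holomorphy in `ζ` for fixed `τ`
    intro τ hτ ζ hζ
    obtain ⟨e1, e2, e3⟩ := poisson_strip_aux (hT (ζ, τ) ⟨hζ, hτ⟩)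
    have e4 : ζ - conj (w τ) ≠ 0 := fun e => e2 (by linear_combination -e)
    have hP : DifferentiableAt ℂ
        (fun ζ : ℂ => ((w τ).im : ℂ) / ((w τ - ζ) * (conj (w τ) - ζ))) ζ :=
      (differentiableAt_const _).div (by fun_prop) (mul_ne_zero e1 e2)
    have hD : DifferentiableAt ℂ (fun ζ : ℂ => (ζ - conj (w τ)) ^ 2) ζ := by fun_prop
    have hK : DifferentiableAt ℂ (fun ζ : ℂ =>
        A τ * (((w τ).im : ℂ) / ((w τ - ζ) * (conj (w τ) - ζ))) ^ s * h₁ +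
          B τ * (I * s / 2 * (((w τ).im : ℂ) / ((w τ - ζ) * (conj (w τ) - ζ))) ^ (s - 1) /
            (ζ - conj (w τ)) ^ 2) * h₂) ζ :=
      (((differentiableAt_const _).mul (hP.cpow_const e3)).mul (differentiableAt_const _)).add
        (((differentiableAt_const _).mul (((differentiableAt_const _).mul
          (hP.cpow_const e3)).div hD (pow_ne_zero 2 e4))).mul (differentiableAt_const _))
    exact hK.differentiableWithinAt
  · -- joint continuity on the strip times `[0, 1]`
    have hA' : ContinuousOn (fun p : ℂ × ℝ => A p.2) ({ζ : ℂ | |ζ.im| < m} ×ˢ Icc (0 : ℝ) 1) :=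
      hA.comp continuous_snd.continuousOn fun p hp => hp.2
    have hB' : ContinuousOn (fun p : ℂ × ℝ => B p.2) ({ζ : ℂ | |ζ.im| < m} ×ˢ Icc (0 : ℝ) 1) :=
      hB.comp continuous_snd.continuousOn fun p hp => hp.2
    have hPc : ContinuousOn
        (fun p : ℂ × ℝ => ((w p.2).im : ℂ) / ((w p.2 - p.1) * (conj (w p.2) - p.1)))
        ({ζ : ℂ | |ζ.im| < m} ×ˢ Icc (0 : ℝ) 1) := by
      refine ContinuousOn.div (by fun_prop) (by fun_prop) fun p hp => ?_
      obtain ⟨e1, e2, -⟩ := poisson_strip_aux (hT p hp)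
      exact mul_ne_zero e1 e2
    have hslit : ∀ p ∈ {ζ : ℂ | |ζ.im| < m} ×ˢ Icc (0 : ℝ) 1,
        ((w p.2).im : ℂ) / ((w p.2 - p.1) * (conj (w p.2) - p.1)) ∈ slitPlane := fun p hp =>
      (poisson_strip_aux (hT p hp)).2.2
    have hden : ContinuousOn (fun p : ℂ × ℝ => (p.1 - conj (w p.2)) ^ 2)
        ({ζ : ℂ | |ζ.im| < m} ×ˢ Icc (0 : ℝ) 1) := by
      fun_prop
    have hden0 : ∀ p ∈ {ζ : ℂ | |ζ.im| < m} ×ˢ Icc (0 : ℝ) 1, (p.1 - conj (w p.2)) ^ 2 ≠ 0 := by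
      intro p hp
      obtain ⟨-, e2, -⟩ := poisson_strip_aux (hT p hp)
      exact pow_ne_zero 2 fun e => e2 (by linear_combination -e)
    have hK : ContinuousOn (fun p : ℂ × ℝ =>
        A p.2 * (((w p.2).im : ℂ) / ((w p.2 - p.1) * (conj (w p.2) - p.1))) ^ s * h₁ +
          B p.2 * (I * s / 2 * (((w p.2).im : ℂ) / ((w p.2 - p.1) * (conj (w p.2) - p.1))) ^
            (s - 1) / (p.1 - conj (w p.2)) ^ 2) * h₂) ({ζ : ℂ | |ζ.im| < m} ×ˢ Icc (0 : ℝ) 1) :=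
      ((hA'.mul (hPc.cpow_const hslit)).mul continuousOn_const).add
        ((hB'.mul ((continuousOn_const.mul (hPc.cpow_const hslit)).div hden hden0)).mul
          continuousOn_const)
    exact hK

/-- **The disc lemma (at `∞`).** For a continuous path `w : [0,1] → {Im z ≥ m} ∩ {|z| ≤ R}`
(`m, R > 0`), continuous `A`, `B` on `[0, 1]` and constants `s, h₁, h₂`, the function
`t ↦ ∫₀¹ (A Q_t^s h₁ + B (i s/2) Q_t^{s-1} (1 + t w̄)^{-2} h₂) dτ`,
`Q_t = Im w / ((1 + t w)(1 + t w̄)) = R(t; -1/w)`, is real-analytic at `t = 0`: the integrand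
continues holomorphically in `t` to the disc `|ζ| < 1/(4R)`, jointly continuously.
[cite: BruggemanLewisZagier2015, (1.7) p. 10 and (2.25) p. 16] -/
theorem analyticAt_integral_disc (s h₁ h₂ : ℂ) {A B w : ℝ → ℂ} {m R : ℝ} (hm : 0 < m)
    (hR : 0 < R) (hA : ContinuousOn A (Icc 0 1)) (hB : ContinuousOn B (Icc 0 1))
    (hw : Continuous w) (hwm : ∀ τ ∈ Icc (0 : ℝ) 1, m ≤ (w τ).im)
    (hwR : ∀ τ ∈ Icc (0 : ℝ) 1, ‖w τ‖ ≤ R) :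
    AnalyticAt ℝ (fun t : ℝ => ∫ τ in (0 : ℝ)..1,
      (A τ * (((w τ).im : ℂ) / ((1 + t * w τ) * (1 + t * conj (w τ)))) ^ s * h₁ +
        B τ * (I * s / 2 * (((w τ).im : ℂ) / ((1 + t * w τ) * (1 + t * conj (w τ)))) ^ (s - 1) /
          (1 + (t : ℂ) * conj (w τ)) ^ 2) * h₂)) 0 := by
  have hS : IsOpen (Metric.ball (0 : ℂ) (1 / (4 * R))) := Metric.isOpen_ball
  have h0 : ((0 : ℝ) : ℂ) ∈ Metric.ball (0 : ℂ) (1 / (4 * R)) := by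
    rw [Complex.ofReal_zero, Metric.mem_ball, dist_self]
    positivity
  have hR' : R ≠ 0 := hR.ne'
  have hT : ∀ p ∈ Metric.ball (0 : ℂ) (1 / (4 * R)) ×ˢ Icc (0 : ℝ) 1,
      0 < (w p.2).im ∧ ‖(p.1 : ℂ)‖ * ‖w p.2‖ ≤ 1 / 4 := by
    intro p hp
    refine ⟨hm.trans_le (hwm _ hp.2), ?_⟩
    have h1 : ‖(p.1 : ℂ)‖ < 1 / (4 * R) := by
      have := hp.1
      rwa [Metric.mem_ball, dist_zero_right] at this
    calc ‖(p.1 : ℂ)‖ * ‖w p.2‖ ≤ 1 / (4 * R) * R :=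
          mul_le_mul h1.le (hwR _ hp.2) (norm_nonneg _) (by positivity)
      _ = 1 / 4 := by field_simp
  refine analyticAt_intervalIntegral_of_differentiableOn
    (K := fun ζ τ => A τ * (((w τ).im : ℂ) / ((1 + ζ * w τ) * (1 + ζ * conj (w τ)))) ^ s * h₁ +
        B τ * (I * s / 2 * (((w τ).im : ℂ) / ((1 + ζ * w τ) * (1 + ζ * conj (w τ)))) ^ (s - 1) /
          (1 + ζ * conj (w τ)) ^ 2) * h₂) hS h0 ?_ ?_
  · -- holomorphy in `ζ` for fixed `τ`
    intro τ hτ ζ hζ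
    obtain ⟨e1, e2, e3⟩ := poisson_disc_aux (hT (ζ, τ) ⟨hζ, hτ⟩).1 (hT (ζ, τ) ⟨hζ, hτ⟩).2
    have hP : DifferentiableAt ℂ
        (fun ζ : ℂ => ((w τ).im : ℂ) / ((1 + ζ * w τ) * (1 + ζ * conj (w τ)))) ζ :=
      (differentiableAt_const _).div (by fun_prop) (mul_ne_zero e1 e2)
    have hD : DifferentiableAt ℂ (fun ζ : ℂ => (1 + ζ * conj (w τ)) ^ 2) ζ := by fun_prop
    have hK : DifferentiableAt ℂ (fun ζ : ℂ =>
        A τ * (((w τ).im : ℂ) / ((1 + ζ * w τ) * (1 + ζ * conj (w τ)))) ^ s * h₁ +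
          B τ * (I * s / 2 * (((w τ).im : ℂ) / ((1 + ζ * w τ) * (1 + ζ * conj (w τ)))) ^
            (s - 1) / (1 + ζ * conj (w τ)) ^ 2) * h₂) ζ :=
      (((differentiableAt_const _).mul (hP.cpow_const e3)).mul (differentiableAt_const _)).add
        (((differentiableAt_const _).mul (((differentiableAt_const _).mul
          (hP.cpow_const e3)).div hD (pow_ne_zero 2 e2))).mul (differentiableAt_const _))
    exact hK.differentiableWithinAt
  · -- joint continuity on the disc times `[0, 1]`
    have hA' : ContinuousOn (fun p : ℂ × ℝ => A p.2)
        (Metric.ball (0 : ℂ) (1 / (4 * R)) ×ˢ Icc (0 : ℝ) 1) :=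
      hA.comp continuous_snd.continuousOn fun p hp => hp.2
    have hB' : ContinuousOn (fun p : ℂ × ℝ => B p.2)
        (Metric.ball (0 : ℂ) (1 / (4 * R)) ×ˢ Icc (0 : ℝ) 1) :=
      hB.comp continuous_snd.continuousOn fun p hp => hp.2
    have hQc : ContinuousOn
        (fun p : ℂ × ℝ => ((w p.2).im : ℂ) / ((1 + p.1 * w p.2) * (1 + p.1 * conj (w p.2))))
        (Metric.ball (0 : ℂ) (1 / (4 * R)) ×ˢ Icc (0 : ℝ) 1) := by
      refine ContinuousOn.div (by fun_prop) (by fun_prop) fun p hp => ?_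
      obtain ⟨e1, e2, -⟩ := poisson_disc_aux (hT p hp).1 (hT p hp).2
      exact mul_ne_zero e1 e2
    have hslit : ∀ p ∈ Metric.ball (0 : ℂ) (1 / (4 * R)) ×ˢ Icc (0 : ℝ) 1,
        ((w p.2).im : ℂ) / ((1 + p.1 * w p.2) * (1 + p.1 * conj (w p.2))) ∈ slitPlane :=
      fun p hp => (poisson_disc_aux (hT p hp).1 (hT p hp).2).2.2
    have hden : ContinuousOn (fun p : ℂ × ℝ => (1 + p.1 * conj (w p.2)) ^ 2)
        (Metric.ball (0 : ℂ) (1 / (4 * R)) ×ˢ Icc (0 : ℝ) 1) := by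
      fun_prop
    have hden0 : ∀ p ∈ Metric.ball (0 : ℂ) (1 / (4 * R)) ×ˢ Icc (0 : ℝ) 1,
        (1 + p.1 * conj (w p.2)) ^ 2 ≠ 0 := fun p hp =>
      pow_ne_zero 2 (poisson_disc_aux (hT p hp).1 (hT p hp).2).2.1
    have hK : ContinuousOn (fun p : ℂ × ℝ =>
        A p.2 * (((w p.2).im : ℂ) / ((1 + p.1 * w p.2) * (1 + p.1 * conj (w p.2)))) ^ s * h₁ +
          B p.2 * (I * s / 2 * (((w p.2).im : ℂ) /
            ((1 + p.1 * w p.2) * (1 + p.1 * conj (w p.2)))) ^ (s - 1) /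
              (1 + p.1 * conj (w p.2)) ^ 2) * h₂)
        (Metric.ball (0 : ℂ) (1 / (4 * R)) ×ˢ Icc (0 : ℝ) 1) :=
      ((hA'.mul (hQc.cpow_const hslit)).mul continuousOn_const).add
        ((hB'.mul ((continuousOn_const.mul (hQc.cpow_const hslit)).div hden hden0)).mul
          continuousOn_const)
    exact hK

/-- **Real-analyticity of the segment period on `ℝ`**: for `U` continuous with continuous real
derivative on `{Im z > 0}`, `a, b` in the open upper half-plane and any `s ∈ ℂ`,
`t ↦ ∫_a^b [U, R(t; ·)^s]` is real-analytic at every `t₀ ∈ ℝ` (strip lemma with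
`m = min (Im a, Im b)`). [cite: BruggemanLewisZagier2015, (1.7) p. 10 and (5.5a) p. 29] -/
theorem analyticAt_greenSegmentIntegral (s : ℂ) {U : ℂ → ℂ}
    (hUc : ContinuousOn U {z : ℂ | 0 < z.im}) (hUd : ContinuousOn (fderiv ℝ U) {z : ℂ | 0 < z.im})
    {a b : ℂ} (ha : 0 < a.im) (hb : 0 < b.im) (t₀ : ℝ) :
    AnalyticAt ℝ (fun t : ℝ => greenSegmentIntegral U (hypPoissonKernelCpow s t) a b) t₀ := by
  obtain ⟨hB, hA⟩ := continuousOn_segment_aux hUc hUd ha hb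
  have hw : Continuous fun τ : ℝ => (1 - (τ : ℂ)) * a + τ * b := by fun_prop
  have key := analyticAt_integral_strip s (b - a) (conj (b - a)) (lt_min ha hb) hA hB hw
    (fun τ hτ => min_im_le_segment_im hτ) t₀
  refine key.congr (Eventually.of_forall fun t => ?_)
  symm
  simp only [greenSegmentIntegral]
  apply intervalIntegral.integral_congr
  intro τ hτ
  rw [uIcc_of_le zero_le_one] at hτ
  exact greenForm_hypPoissonKernelCpow s U t ((lt_min ha hb).trans_le (min_im_le_segment_im hτ))
    (b - a)

/-- **Real-analyticity of the segment period at `∞`**: with `U`, `a`, `b`, `s` as above there is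
`ψ`, real-analytic at `0`, with `ψ(t) = |t|^{-2s} ∫_a^b [U, R(-1/t; ·)^s]` for `t ≠ 0` — namely
the disc-lemma integral with `R = ‖a‖ + ‖b‖ + 1` (the integrand rewritten via `R(t; -1/z)`,
BLZ (2.25) with `g = S`). [cite: BruggemanLewisZagier2015, (2.25) p. 16 and (5.5a) p. 29] -/
theorem analyticAt_infty_greenSegmentIntegral (s : ℂ) {U : ℂ → ℂ}
    (hUc : ContinuousOn U {z : ℂ | 0 < z.im}) (hUd : ContinuousOn (fderiv ℝ U) {z : ℂ | 0 < z.im})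
    {a b : ℂ} (ha : 0 < a.im) (hb : 0 < b.im) :
    ∃ ψ : ℝ → ℂ, AnalyticAt ℝ ψ 0 ∧ ∀ t : ℝ, t ≠ 0 →
      ψ t = ((|t| : ℝ) : ℂ) ^ (-(2 * s)) *
        greenSegmentIntegral U (hypPoissonKernelCpow s (-1 / t)) a b := by
  obtain ⟨hB, hA⟩ := continuousOn_segment_aux hUc hUd ha hb
  have hw : Continuous fun τ : ℝ => (1 - (τ : ℂ)) * a + τ * b := by fun_prop
  have hR : 0 < ‖a‖ + ‖b‖ + 1 := by positivity
  have key := analyticAt_integral_disc s (b - a) (conj (b - a)) (lt_min ha hb) hR hA hB hw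
    (fun τ hτ => min_im_le_segment_im hτ)
    (fun τ hτ => (norm_segment_le hτ).trans (le_add_of_nonneg_right zero_le_one))
  refine ⟨_, key, fun t ht => ?_⟩
  simp only [greenSegmentIntegral]
  rw [← intervalIntegral.integral_const_mul]
  apply intervalIntegral.integral_congr
  intro τ hτ
  rw [uIcc_of_le zero_le_one] at hτ
  exact (greenForm_hypPoissonKernelCpow_infty s U ht
    ((lt_min ha hb).trans_le (min_im_le_segment_im hτ)) (b - a)).symm

/-- **The segment period is an analytic vector.** For `U : ℂ → ℂ` continuous with continuous real
derivative on `{Im z > 0}`, `a, b` in the open upper half-plane and any `s ∈ ℂ`, the function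
`t ↦ ∫_a^b [U, R(t; ·)^s]` (Euclidean segment) belongs to `V_s^ω` in the line model.
[cite: BruggemanLewisZagier2015, (5.5a) p. 29] -/
theorem isAnalyticVector_greenSegmentIntegral (s : ℂ) {U : ℂ → ℂ}
    (hUc : ContinuousOn U {z : ℂ | 0 < z.im}) (hUd : ContinuousOn (fderiv ℝ U) {z : ℂ | 0 < z.im})
    {a b : ℂ} (ha : 0 < a.im) (hb : 0 < b.im) :
    IsAnalyticVector s (fun t : ℝ => greenSegmentIntegral U (hypPoissonKernelCpow s t) a b) := by
  refine ⟨fun t _ => analyticAt_greenSegmentIntegral s hUc hUd ha hb t, ?_⟩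
  obtain ⟨ψ, hψ, hψeq⟩ := analyticAt_infty_greenSegmentIntegral s hUc hUd ha hb
  exact ⟨ψ, hψ, hψeq⟩

/-- **`r_γ ∈ V_s^ω` for the period integral of a `C²` function on `ℍ`.** For `u : ℍ → ℂ` of class
`C²`, any `a, b ∈ ℍ` and any `s ∈ ℂ`, `t ↦ ∫_a^b [u, R(t; ·)^s]` is an analytic vector; neither
the eigenfunction property nor `0 < Re s < 1` is needed for this.
[cite: BruggemanLewisZagier2015, (5.5a) p. 29] -/
theorem isAnalyticVector_greenPeriod (s : ℂ) {u : UpperHalfPlane → ℂ} (hu : IsC2 u)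
    (a b : UpperHalfPlane) : IsAnalyticVector s (greenPeriod s u a b) :=
  isAnalyticVector_greenSegmentIntegral s hu.continuousOn
    (hu.continuousOn_fderiv_of_isOpen (isOpen_lt continuous_const Complex.continuous_im)
      (by norm_num))
    a.im_pos b.im_pos

/-- **The period cocycle is `V_s^ω`-valued.** [cite: BruggemanLewisZagier2015, (5.5a) p. 29] -/
theorem isAnalyticVector_lewisZagierCocycle (s : ℂ) (z₀ : UpperHalfPlane) {u : UpperHalfPlane → ℂ}
    (hu : IsC2 u) (γ : GL (Fin 2) ℝ) : IsAnalyticVector s (lewisZagierCocycle s z₀ u γ) :=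
  isAnalyticVector_greenPeriod s hu _ _

/-! ### 5. The named fact -/

/-- **BLZ, p. 29: "So `r_γ ∈ V_s^ω`"** — discharge of the named fact
`BruggemanLewisZagier2015_cocycle_analytic`: for `Γ ≤ GL₂(ℝ)` of determinant one, `u ∈ E_s^Γ`
(`0 < Re s < 1`), `z₀ ∈ ℍ` and `γ ∈ Γ`, the period function `r_γ` is an analytic vector of the
line model. (Only `u ∈ C²(ℍ)` is used.) [cite: BruggemanLewisZagier2015, (5.5a) p. 29] -/
theorem BruggemanLewisZagier2015_cocycle_analytic_holds :
    BruggemanLewisZagier2015_cocycle_analytic :=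
  fun _Γ _ s _ _ _u hu z₀ γ _ => isAnalyticVector_lewisZagierCocycle s z₀ hu.isC2 γ

end Literature.NumberTheory.Automorphic

end
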